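import Mathlib
import Literature.AlgebraicGeometry.CossartPiltant200819.Thm15FrameSHE2019
import Literature.AlgebraicGeometry.Resolution.LocalBlowup
import Literature.AlgebraicGeometry.Resolution.ExcellentRings
import HarnessLib

/-!
# Crux `DescentPerfectToAll` (stmt-ResolutionOfSingularities-0549) — lens 6 «negation at crux level», generation 3
# res-B-lens-6 g3, 2026-08-28.  NEGATION WITH TEETH ON A MECHANISM SHAPE: the Cossart–Piltant «frame».

Companion memo (the mathematics, paper-rigorous): `Cruxes/DescentPerfectToAll/NEGATION-lens6-g3.md`.

WHAT IS NEGATED (on paper, memo §1; this file types the targets and kernel-checks the arithmetic core):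
for `p = 5` and EVERY `n ≥ 2` the base-side frame statement `FrameAtDim n` — verbatim lens-5's `ViaCpFrame.CpFrameAtDim n`
(`Lines/via_cp_frame.lean`), i.e. INPUTS F-110 `CossartPiltant2019_thm_1_5_i_frame` with `dim S = 3 ↦ dim S = n` — is FALSE.
Witness: `k = 𝔽₅`, `S = k[x,y,w₁,…,w_{n-2}]_{(x,y,w)}`, `f = x²y`, `O` = (golden monomial valuation in `(x,y)` over `k(w)`) ∘ (any
zero-dimensional valuation of `k(w)` at the origin).  Along `O` NO regular local ring `B ⊇ S` dominated by `O` admits an element of the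
`K⁵`-line `M = K⁵(x²y)` as a regular parameter (memo §1, steps A–E: value character `χ`, Abhyankar's factorization of 2-dimensional
regular local rings [Abhyankar 1956, Thm 3], Lucas numbers mod 5, and `d(c⁵) = 0`), hence no `B_r[X]/(X⁵ - g_r)` with `g_r ∈ M` is
regular, whatever the tower.  Consequences (memo §3): F-110 is false AS TYPED (its READING (c) is stronger than print: CP 2019 run the
frame only at points of multiplicity `p` and finish points of multiplicity `< p` by [CP 2014] Main Thm 1.3, Cor. 5.6 p. 405); lens-5's
S2 `stub_cpFrameDimGEFour` is false; the 15917 skeleton's `stub_cp2019Thm15iFrame` (= F-110) is false; theorems taking the frame as a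
HYPOTHESIS (p659057 `cleanLU_of_frame_of_dimThreeCentre`, `stub_cleanLU3_of_frame`) stay true but are vacuous.  The toric-clean
statements (`CleanLU3`, `CleanLUAtDim n`, `CleanModels`, L1's `stub_cleanModelsDimGEFour`) are UNTOUCHED: the witness is monomially
clean at every model.  Rung B (`DescentPerfectToAll`) is untouched (g1: negatively dominated).

HONESTY.  Nothing here proves or refutes resolution of singularities in characteristic `p`, rung B, or `CleanModels`.  The negation
targets below are `def`s (Props), not theorems: the paper proof is in the memo; a Lean refutation of F-110 is refuter work (it needs the
composite valuation as a `ValuationSubring`).  0 sorry.  [OURS · CANDIDATE] counted 0.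
-/

noncomputable section

set_option linter.dupNamespace false

open Literature.AlgebraicGeometry.Resolution

namespace Summit.ResolutionOfSingularities.ResolutionOfSingularities.Cruxes.DescentPerfectToAll.NegationLens6g3

/-! ## 1. The frame shape at dimension `n` and the typed negation targets -/

/-- **The Cossart–Piltant base-side frame at dimension `n`** — VERBATIM lens-5's `ViaCpFrame.CpFrameAtDim` (`Lines/via_cp_frame.lean`;
copied, not imported, because that module carries sorried stubs): INPUTS F-110 with `ringKrullDim S = 3` replaced by `= n`.
[cite: CossartPiltant2019, Thm. 1.5 (i), Prop. 2.22] -/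
def FrameAtDim (n : ℕ) : Prop :=
  ∀ (p : ℕ), p.Prime →
    ∀ (S : Type) [CommRing S] [IsRegularLocalRing S],
      IsExcellentRing S → ringKrullDim S = (n : WithBot ℕ∞) → CharP S p →
    ∀ (K : Type) [Field K] [Algebra S K] [IsFractionRing S K] (f : S),
      (∀ c : K, c ^ p ≠ algebraMap S K f) →
    ∀ (O : ValuationSubring K), (algebraMap S K).range ≤ O.toSubring →
      (∀ s ∈ IsLocalRing.maximalIdeal S, O.valuation (algebraMap S K s) < 1) →
    ∃ (r : ℕ) (B : ℕ → Subring K) (g : ℕ → K),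
      B 0 = locAtCentre (algebraMap S K).range O ∧ g 0 = algebraMap S K f ∧
      (∀ i ≤ r, B i ≤ O.toSubring ∧ IsRegularLocalRing (B i) ∧ g i ∈ B i) ∧
      (∀ i < r, ∃ P : Ideal (B i), IsRegularLocalRing ((B i) ⧸ P) ∧
        IsLocalBlowupAlong O (B i) P (B (i + 1)) ∧
        ∃ c d : K, c ≠ 0 ∧ g (i + 1) = c ^ p * g i + d ^ p) ∧
      ∀ hg : g r ∈ B r, IsRegularLocalRing (AdjoinRoot (Polynomial.X ^ p - Polynomial.C (⟨g r, hg⟩ : B r)))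

/-- `FrameAtDim 3` IS the landed named fact F-110, up to the cast `((3 : ℕ) : WithBot ℕ∞) = 3` (same certificate as lens-5's
`cpFrameAtDim_three_iff`). [cite: CossartPiltant2019, Thm. 1.5 (i), Prop. 2.22] -/
theorem frameAtDim_three_iff :
    FrameAtDim 3 ↔ Literature.AlgebraicGeometry.CossartPiltant200819.CossartPiltant2019_thm_1_5_i_frame.{0} := by
  simp only [FrameAtDim, Literature.AlgebraicGeometry.CossartPiltant200819.CossartPiltant2019_thm_1_5_i_frame, Nat.cast_ofNat]

/-- **NEGATION TARGET `N(n)`** (memo §1 proves it on paper for every `n ≥ 2`, witness at `p = 5`): the frame fails at dimension `n`.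
A `def`, not a theorem. [folklore] -/
def FrameFailsAtDim (n : ℕ) : Prop := ¬ FrameAtDim n

/-- **NEGATION TARGET**: INPUTS F-110 is false as typed (= `N(3)`). A `def`, not a theorem; refuter target. [folklore] -/
def F110False : Prop :=
  ¬ Literature.AlgebraicGeometry.CossartPiltant200819.CossartPiltant2019_thm_1_5_i_frame.{0}

/-- `N(3)` is literally the negation of F-110. [folklore] -/
theorem f110False_iff_frameFails_three : F110False ↔ FrameFailsAtDim 3 := by
  simp only [F110False, FrameFailsAtDim, frameAtDim_three_iff]

/-- `N(4)` kills lens-5's research stub S2 `stub_cpFrameDimGEFour : ∀ n ≥ 4, CpFrameAtDim n` (same body as `FrameAtDim`). [folklore] -/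
theorem not_frame_dimGEFour_of_frameFails_four (h : FrameFailsAtDim 4) : ¬ (∀ n : ℕ, 4 ≤ n → FrameAtDim n) :=
  fun H => h (H 4 le_rfl)

/-- Conversely the all-dimensions frame would give F-110's shape one dimension up; recorded only to fix directions. [folklore] -/
theorem frameFails_of_not_frame {n : ℕ} (h : ¬ FrameAtDim n) : FrameFailsAtDim n := h

/-! ## 2. Kernel-checked arithmetic core of the witness (memo §1, steps A and C)

Values of the golden valuation live in `Γ₁ = ℤ + ℤφ`, encoded as pairs `(m, n) ↦ m + nφ`.  The character `χ(m + nφ) = m - 2n (mod 5)`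
kills `5Γ₁` and `μ₁(x²y) = 2 + φ`, hence the `μ₁`-value of every element of `M ∖ K⁵` (step A); it never vanishes on the regular
parameters of the golden quadratic sequence, whose values `r₀ = φ, r₁ = 1, r_{k+2} = r_k - r_{k+1}` have `χ = ±` Lucas numbers (step C). -/

/-- `χ(m + nφ) := m - 2n mod 5`. -/
def chi (v : ℤ × ℤ) : ZMod 5 := (v.1 : ZMod 5) - 2 * (v.2 : ZMod 5)

theorem chi_sub (v w : ℤ × ℤ) : chi (v - w) = chi v - chi w := by
  simp only [chi, Prod.fst_sub, Prod.snd_sub, Int.cast_sub]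
  ring

/-- Step A: `χ` vanishes on `5Γ₁ + ℤ·(2 + φ)` — the set of `μ₁`-values of `M ∖ K⁵`, `M = K⁵(x²y)`. [folklore] -/
theorem chi_lineValue (a b j : ℤ) : chi (5 * a + 2 * j, 5 * b + j) = 0 := by
  have h5 : (5 : ZMod 5) = 0 := by decide
  simp only [chi, Int.cast_add, Int.cast_mul, Int.cast_ofNat]
  linear_combination ((a : ZMod 5) - 2 * (b : ZMod 5)) * h5

/-- The golden remainder sequence `r₀ = φ = (0,1)`, `r₁ = 1 = (1,0)`, `r_{k+2} = r_k - r_{k+1}` (`φ-1, 2-φ, 2φ-3, 5-3φ, …`): the regular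
parameters of the `k`-th quadratic transform of `k(w)[x,y]_{(x,y)}` along the golden valuation have `μ₁`-values `{r_k, r_{k+1}}`. -/
def gold : ℕ → ℤ × ℤ
  | 0 => (0, 1)
  | 1 => (1, 0)
  | (k + 2) => gold k - gold (k + 1)

/-- Consecutive `χ`-values of the golden sequence. -/
def chiPair (k : ℕ) : ZMod 5 × ZMod 5 := (chi (gold k), chi (gold (k + 1)))

theorem chiPair_zero : chiPair 0 = (3, 1) := by decide

theorem chiPair_succ (k : ℕ) : chiPair (k + 1) = ((chiPair k).2, (chiPair k).1 - (chiPair k).2) := by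
  have hg : gold (k + 1 + 1) = gold k - gold (k + 1) := rfl
  simp only [chiPair, hg, chi_sub]

/-- The 4-cycle of `χ`-pairs. -/
def cyc : Finset (ZMod 5 × ZMod 5) := {(3, 1), (1, 2), (2, 4), (4, 3)}

theorem chiPair_mem_cyc (k : ℕ) : chiPair k ∈ cyc := by
  induction k with
  | zero => rw [chiPair_zero]; decide
  | succ k ih =>
    rw [chiPair_succ]
    have hinv : ∀ q ∈ cyc, (q.2, q.1 - q.2) ∈ cyc := by decide
    exact hinv _ ih

/-- Step C: `χ` never vanishes on a golden parameter value (equivalently: `5` divides no Lucas number). [folklore] -/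
theorem chi_gold_ne_zero (k : ℕ) : chi (gold k) ≠ 0 := by
  have hne : ∀ q ∈ cyc, q.1 ≠ 0 := by decide
  exact hne _ (chiPair_mem_cyc k)

/-- Steps A + C combined, the contradiction engine of memo §1: a `μ₁`-value that is simultaneously a golden parameter value `r_k` and an
`M ∖ K⁵`-value `5Γ₁ + j(2+φ)` does not exist. [folklore] -/
theorem gold_ne_lineValue (k : ℕ) (a b j : ℤ) : gold k ≠ (5 * a + 2 * j, 5 * b + j) := by
  intro h
  have h0 := chi_lineValue a b j
  rw [← h] at h0
  exact chi_gold_ne_zero k h0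


end Summit.ResolutionOfSingularities.ResolutionOfSingularities.Cruxes.DescentPerfectToAll.NegationLens6g3

end
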